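import Summits.MatrixMultiplication.MatrixMultiplication.Theorems.SoloInformedLopsidedLadder
import Literature.Computability.AlgebraicComplexity.BorderRankMatMulRectangularProofs
import HarnessLib

/-!
# The two-sided ladder: `ω = 2` iff every `⟨n,n,m⟩` has asymptotic rank = flattening rank

Solo-informed seat, gen 31 (s1, second file).  The lopsided ladder `R̃(⟨n,n,2⟩) = n²`
(`SoloInformedLopsidedLadder.lean`) is the `m = 2` column of a two-parameter family.  With the
DEFECT `δ(q) := ω(1,1,q) − max(2, q+1) ≥ 0` (`max_two_add_one_le_omegaRect`) and the real-exponent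
identity `R̃(⟨n,n,m⟩) = n^{ω(1,1,log_n m)}` of the previous file:

* `omegaRect_sub_max_le_omega_sub_two` — THE SUMMIT IS THE PEAK: `δ(q) ≤ δ(1) = ω − 2` for all
  real `q` (monotonicity below `1`, the Lipschitz bound `ω(1,1,p) ≤ ω(1,1,q) + (p − q)` above `1`);
  hence `omega_eq_two_iff_forall_omegaRect_eq_max : ω = 2 ↔ ∀ q, ω(1,1,q) = max(2, q+1)` and,
  tensorially, `omega_eq_two_iff_forall_asymptoticRank_eq_flattening :
  ω = 2 ↔ ∀ n ≥ 2, m ≥ 1, R̃(⟨n,n,m⟩) = max(n², n·m)` (every field).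
* LEFT of the summit (`m < n`) the defect vanishes identically on `[0, α]`, `α ≥ 0.321334` over `ℂ`
  (previous file: rungs `n ≥ 9`).  RIGHT of the summit (`m = n^k`, `k ≥ 1`): the right rungs
  `ρ_k :⟺ ω(1,1,k) = k + 1 ⟺ R̃(⟨n,n,n^k⟩) ≤ n^{k+1}` (`asymptoticRank_right_le_iff`, any base
  `n ≥ 2`: `asymptoticRank_right_le_iff_base_two`) form a DESCENDING chain of consequences of `ω = 2`
  (`omegaRect_eq_add_one_mono`: `ρ_k → ρ_{k'}` for `k ≤ k'`, from the Lipschitz bound; e.g.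
  `MatrixMultiplication → R̃(⟨2,2,4⟩) ≤ 8 → R̃(⟨2,2,8⟩) ≤ 16`), NONE of which is known for a finite `k`
  ("the best lower bound on `ω(p)` has remained `max(2, 1+p)`", CLLZ 2020 §1), while the LIMIT is a
  theorem: `ω(1,1,k) − k → 1` (Coppersmith 1982; Lotti–Romani 1983, Prop. 4.1, via Schönhage's
  `⟨k,1,n⟩ ⊕ ⟨1,(k−1)(n−1),1⟩`) — recorded here only as the hypothesis of
  `right_defect_eventually_le`.  CW_q-methods are barred from every right rung already at `k = 2`
  (CLLZ 2020, Table "barriers for `ω(2)` via `CW_q`": `3.0551 (q=1) … 3.1713 (q=14) > 3`; evidence,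
  not kernel).
* Numerics given VWXXZ 2024 Table 1 (`vxxz2024_omegaRect_table`): `R̃(⟨2,2,4⟩) ≤ 2^{3.250385} < 12 ≤
  R̲(⟨2,2,4⟩)` and `R̃(⟨2,2,8⟩) ≤ 2^{4.198809} < 24 ≤ R̲(⟨2,2,8⟩)` (Landsberg–Ryder `3n ≤ R̲(⟨2,2,n⟩)`);
  and NEVER ATTAINED on the right too: `(n^{k+1})^N < R̲(⟨n,n,n^k⟩^{⊠N})` for all `N ≥ 1` (Lickteig).

References: Coppersmith, SIAM J. Comput. 11 (1982) 467–471; Lotti–Romani, Theoret. Comput. Sci. 23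
(1983) 171–185, Prop. 4.1 (held: `paper:doi-10-1016-0304-3975-83-90054-3`, pp. 180–181);
Christandl–Le Gall–Lysikov–Zuiddam, arXiv:2003.03019, §1 and §4.4 (table for `ω(2)`);
Vassilevska Williams–Xu–Xu–Zhou 2024, Table 1; Landsberg–Ryder 2015 §3; Lickteig 1984.
-/

set_option linter.dupNamespace false

namespace Summit.MatrixMultiplication.MatrixMultiplication.Theorems

open Literature.Computability.AlgebraicComplexity

variable (K : Type) [Field K]

/-! ## The defect `ω(1,1,q) − max(2, q+1)` and its peak at the summit -/

/-- Both flattening bounds: `max(2, q+1) ≤ ω(1,1,q)`. [cite: Blaser2013, Lemma 7.1 (2)]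
[cite: ChristandlLeGallLysikovZuiddam2020, §1] -/
theorem max_two_add_one_le_omegaRect (q : ℝ) : max 2 (q + 1) ≤ omegaRect K 1 1 q := by
  refine max_le (two_le_omegaRect_one_one K q) ?_
  rw [← omegaRect_one_mid_one]
  exact add_one_le_omegaRect_one_mid_one K q

/-- **The summit is the peak of the defect**: `ω(1,1,q) − max(2, q+1) ≤ ω − 2` for every real `q`
(`q ≤ 1`: monotonicity `ω(1,1,q) ≤ ω(1,1,1) = ω`; `q ≥ 1`: `ω(1,1,q) ≤ ω + (q − 1)`).
[cite: LottiRomani1983, §2 (p. 174)] -/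
theorem omegaRect_sub_max_le_omega_sub_two (q : ℝ) :
    omegaRect K 1 1 q - max 2 (q + 1) ≤ omega K - 2 := by
  rcases le_total q 1 with h | h
  · have h1 : omegaRect K 1 1 q ≤ omegaRect K 1 1 1 := by
      rw [← omegaRect_one_mid_one, ← omegaRect_one_mid_one]
      exact omegaRect_one_mid_one_mono K h
    rw [omegaRect_one_one_one] at h1
    have h2 : (2 : ℝ) ≤ max 2 (q + 1) := le_max_left _ _
    linarith
  · have h1 := omegaRect_one_one_le_add K h
    rw [omegaRect_one_one_one] at h1
    have h2 : q + 1 ≤ max 2 (q + 1) := le_max_right _ _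
    linarith

/-- **`ω = 2` iff the defect vanishes identically**: `ω = 2 ↔ ∀ q, ω(1,1,q) = max(2, q+1)`
("if `ω = 2`, then `ω(p) = max(2, 1+p)`", CLLZ 2020 §1; conversely `q = 1`).
[cite: ChristandlLeGallLysikovZuiddam2020, §1] -/
theorem omega_eq_two_iff_forall_omegaRect_eq_max :
    omega K = 2 ↔ ∀ q : ℝ, omegaRect K 1 1 q = max 2 (q + 1) := by
  constructor
  · intro h q
    have h1 := omegaRect_sub_max_le_omega_sub_two K q
    have h2 := max_two_add_one_le_omegaRect K q
    rw [h] at h1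
    linarith
  · intro h
    have h1 := h 1
    rw [omegaRect_one_one_one] at h1
    rw [h1]
    norm_num

/-- **Two-sided single-tensor form**: `ω = 2 ↔` every `⟨n,n,m⟩` (`n ≥ 2`, `m ≥ 1`) has asymptotic
rank equal to its flattening rank `max(n², n·m)` (the real-exponent identity
`R̃(⟨n,n,m⟩) = n^{ω(1,1,log_n m)}`; conversely `n = m = 2`). [cite: ChristandlLeGallLysikovZuiddam2020, §1]
[cite: AlmanDuanVassilevskaWilliamsXuXuZhou2025, §3.4] -/
theorem omega_eq_two_iff_forall_asymptoticRank_eq_flattening :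
    omega K = 2 ↔ ∀ n m : ℕ, 2 ≤ n → 1 ≤ m →
      asymptoticRank (matMulTensor K n n m) = max ((n : ℝ) ^ 2) ((n : ℝ) * m) := by
  constructor
  · intro h n m hn hm
    have hn1 : (1 : ℝ) < n := by exact_mod_cast hn
    have hn0 : (0 : ℝ) < n := by linarith
    have hm0 : (0 : ℝ) < m := by exact_mod_cast (by omega : 0 < m)
    rw [asymptoticRank_matMulTensor_eq_rpow_omegaRect_logb K hn hm,
      (omega_eq_two_iff_forall_omegaRect_eq_max K).1 h]
    have e1 : (n : ℝ) ^ (Real.logb n m + 1) = (n : ℝ) * m := by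
      rw [Real.rpow_add hn0, Real.rpow_one, Real.rpow_logb hn0 hn1.ne' hm0, mul_comm]
    have e2 : (n : ℝ) ^ (2 : ℝ) = (n : ℝ) ^ 2 := by norm_num
    rcases le_total 2 (Real.logb n m + 1) with hc | hc
    · rw [max_eq_right hc, e1]
      symm
      apply max_eq_right
      rw [← e1, ← e2]
      exact Real.rpow_le_rpow_of_exponent_le hn1.le hc
    · rw [max_eq_left hc, e2]
      symm
      apply max_eq_left
      rw [← e1, ← e2]
      exact Real.rpow_le_rpow_of_exponent_le hn1.le hc
  · intro h
    have h2 := h 2 2 le_rfl (by norm_num)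
    rw [← asymptoticRank_two_le_four_iff_omega_eq_two K, h2]
    norm_num

/-! ## The right ladder `ω(1,1,k) = k + 1` -/

/-- The defect is non-increasing to the right: `ω(1,1,k') − (k'+1) ≤ ω(1,1,k) − (k+1)` for `k ≤ k'`
(the Lipschitz bound `ω(1,1,k') ≤ ω(1,1,k) + (k' − k)`). [cite: LottiRomani1983, §2 (p. 174)] -/
theorem omegaRect_sub_add_one_antitone {k k' : ℝ} (hkk : k ≤ k') :
    omegaRect K 1 1 k' - (k' + 1) ≤ omegaRect K 1 1 k - (k + 1) := by
  have h := omegaRect_one_one_le_add K hkk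
  linarith

/-- **Right rungs are monotone**: `ω(1,1,k) = k + 1 → ω(1,1,k') = k' + 1` for `k ≤ k'`.
[cite: LottiRomani1983, §2 (p. 174)] -/
theorem omegaRect_eq_add_one_mono {k k' : ℝ} (hkk : k ≤ k') (h : omegaRect K 1 1 k = k + 1) :
    omegaRect K 1 1 k' = k' + 1 := by
  have h1 := omegaRect_sub_add_one_antitone K hkk
  have h2 := max_two_add_one_le_omegaRect K k'
  have h3 : k' + 1 ≤ max 2 (k' + 1) := le_max_right _ _
  linarith

/-- **Coppersmith 1982 / Lotti–Romani 1983, Prop. 4.1** state `inf_k (ω(1,1,k) − k) = 1`; taken as the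
hypothesis `hLR`, the defect is then EVENTUALLY `≤ ε` (antitonicity), while its value at `k = 1` is
`ω − 2`. [cite: LottiRomani1983, Prop. 4.1 (pp. 180–181)] -/
theorem right_defect_eventually_le
    (hLR : ∀ ε : ℝ, 0 < ε → ∃ k : ℝ, omegaRect K 1 1 k ≤ k + 1 + ε) {ε : ℝ} (hε : 0 < ε) :
    ∃ k₀ : ℝ, ∀ k : ℝ, k₀ ≤ k → omegaRect K 1 1 k ≤ k + 1 + ε := by
  obtain ⟨k₀, hk₀⟩ := hLR ε hε
  refine ⟨k₀, fun k hk => ?_⟩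
  have h := omegaRect_sub_add_one_antitone K hk
  linarith

/-- `R̃(⟨n,n,n^k⟩) = n^{ω(1,1,k)}` (the real-exponent identity at `m = n^k`, `log_n n^k = k`).
[cite: AlmanDuanVassilevskaWilliamsXuXuZhou2025, §3.4] -/
theorem asymptoticRank_matMulTensor_right {n : ℕ} (hn : 2 ≤ n) (k : ℕ) :
    asymptoticRank (matMulTensor K n n (n ^ k)) = (n : ℝ) ^ omegaRect K 1 1 (k : ℝ) := by
  have hn1 : (1 : ℝ) < n := by exact_mod_cast hn
  have hk1 : 1 ≤ n ^ k := Nat.one_le_pow _ _ (by omega)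
  rw [asymptoticRank_matMulTensor_eq_rpow_omegaRect_logb K hn hk1, Nat.cast_pow,
    ← Real.rpow_natCast, Real.logb_rpow (by linarith) hn1.ne']

/-- Flattening on the right: `n^{k+1} ≤ R̃(⟨n,n,n^k⟩)`. [cite: Blaser2013, Lemma 7.1 (2)] -/
theorem pow_succ_le_asymptoticRank_right {n : ℕ} (hn : 2 ≤ n) (k : ℕ) :
    (n : ℝ) ^ (k + 1) ≤ asymptoticRank (matMulTensor K n n (n ^ k)) := by
  rw [asymptoticRank_matMulTensor_right K hn k]
  have hn1 : (1 : ℝ) ≤ n := by exact_mod_cast (by omega : 1 ≤ n)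
  have hlow : (k : ℝ) + 1 ≤ omegaRect K 1 1 k := by
    have := add_one_le_omegaRect_one_mid_one K (k : ℝ)
    rwa [omegaRect_one_mid_one] at this
  calc (n : ℝ) ^ (k + 1) = (n : ℝ) ^ ((k : ℝ) + 1) := by norm_cast
    _ ≤ (n : ℝ) ^ omegaRect K 1 1 k := Real.rpow_le_rpow_of_exponent_le hn1 hlow

/-- **The right rung `ρ_k` as a single-tensor statement**: `R̃(⟨n,n,n^k⟩) ≤ n^{k+1} ↔ ω(1,1,k) = k+1`
(`n ≥ 2`). [cite: AlmanDuanVassilevskaWilliamsXuXuZhou2025, §3.4] -/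
theorem asymptoticRank_right_le_iff {n : ℕ} (hn : 2 ≤ n) (k : ℕ) :
    asymptoticRank (matMulTensor K n n (n ^ k)) ≤ (n : ℝ) ^ (k + 1) ↔
      omegaRect K 1 1 (k : ℝ) = k + 1 := by
  rw [asymptoticRank_matMulTensor_right K hn k]
  have hn1 : (1 : ℝ) < n := by exact_mod_cast hn
  have hlow : (k : ℝ) + 1 ≤ omegaRect K 1 1 k := by
    have := add_one_le_omegaRect_one_mid_one K (k : ℝ)
    rwa [omegaRect_one_mid_one] at this
  rw [show ((n : ℝ) ^ (k + 1) : ℝ) = (n : ℝ) ^ ((k : ℝ) + 1) by norm_cast,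
    Real.rpow_le_rpow_left_iff hn1]
  exact ⟨fun h => le_antisymm h hlow, fun h => h.le⟩

/-- **Base independence**: `R̃(⟨n,n,n^k⟩) ≤ n^{k+1} ↔ R̃(⟨2,2,2^k⟩) ≤ 2^{k+1}` for every `n ≥ 2` (both
say `ω(1,1,k) = k+1`; e.g. `R̃(⟨2,2,4⟩) = 8 ⟺ R̃(⟨3,3,9⟩) = 27 ⟺ R̃(⟨10,10,100⟩) = 1000`).
[cite: AlmanDuanVassilevskaWilliamsXuXuZhou2025, §3.4] -/
theorem asymptoticRank_right_le_iff_base_two {n : ℕ} (hn : 2 ≤ n) (k : ℕ) :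
    asymptoticRank (matMulTensor K n n (n ^ k)) ≤ (n : ℝ) ^ (k + 1) ↔
      asymptoticRank (matMulTensor K 2 2 (2 ^ k)) ≤ ((2 : ℕ) : ℝ) ^ (k + 1) := by
  rw [asymptoticRank_right_le_iff K hn k, asymptoticRank_right_le_iff K le_rfl k]

/-- **`ω = 2` gives every right rung**: `R̃(⟨n,n,n^k⟩) ≤ n^{k+1}` (`n ≥ 2`, `k ≥ 1`).
[cite: ChristandlLeGallLysikovZuiddam2020, §1] -/
theorem asymptoticRank_right_le_of_omega_eq_two (h : omega K = 2) {n : ℕ} (hn : 2 ≤ n) {k : ℕ}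
    (hk : 1 ≤ k) : asymptoticRank (matMulTensor K n n (n ^ k)) ≤ (n : ℝ) ^ (k + 1) := by
  rw [asymptoticRank_right_le_iff K hn k,
    (omega_eq_two_iff_forall_omegaRect_eq_max K).1 h k]
  have hk1 : (1 : ℝ) ≤ k := by exact_mod_cast hk
  exact max_eq_right (by linarith)

/-- **Right rungs descend**: `R̃(⟨n,n,n^k⟩) ≤ n^{k+1} → R̃(⟨n,n,n^{k'}⟩) ≤ n^{k'+1}` for `k ≤ k'`.
[cite: LottiRomani1983, §2 (p. 174)] -/
theorem right_rung_mono {n : ℕ} (hn : 2 ≤ n) {k k' : ℕ} (hkk : k ≤ k')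
    (h : asymptoticRank (matMulTensor K n n (n ^ k)) ≤ (n : ℝ) ^ (k + 1)) :
    asymptoticRank (matMulTensor K n n (n ^ k')) ≤ (n : ℝ) ^ (k' + 1) := by
  rw [asymptoticRank_right_le_iff K hn] at h ⊢
  exact omegaRect_eq_add_one_mono K (by exact_mod_cast hkk) h

/-- `log_2 4 = 2`. [folklore] -/
theorem logb_two_four : Real.logb 2 4 = 2 := by
  rw [show (4 : ℝ) = (2 : ℝ) ^ ((2 : ℕ) : ℝ) by norm_num, Real.logb_rpow (by norm_num) (by norm_num)]
  norm_num

/-- `log_2 8 = 3`. [folklore] -/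
theorem logb_two_eight : Real.logb 2 8 = 3 := by
  rw [show (8 : ℝ) = (2 : ℝ) ^ ((3 : ℕ) : ℝ) by norm_num, Real.logb_rpow (by norm_num) (by norm_num)]
  norm_num

/-- `R̃(⟨2,2,4⟩) = 2^{ω(1,1,2)}`. [cite: AlmanDuanVassilevskaWilliamsXuXuZhou2025, §3.4] -/
theorem asymptoticRank_224_eq_rpow :
    asymptoticRank (matMulTensor K 2 2 4) = (2 : ℝ) ^ omegaRect K 1 1 2 := by
  rw [asymptoticRank_matMulTensor_eq_rpow_omegaRect_logb K (le_refl 2) (by norm_num : 1 ≤ 4)]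
  norm_num [logb_two_four]

/-- `R̃(⟨2,2,8⟩) = 2^{ω(1,1,3)}`. [cite: AlmanDuanVassilevskaWilliamsXuXuZhou2025, §3.4] -/
theorem asymptoticRank_228_eq_rpow :
    asymptoticRank (matMulTensor K 2 2 8) = (2 : ℝ) ^ omegaRect K 1 1 3 := by
  rw [asymptoticRank_matMulTensor_eq_rpow_omegaRect_logb K (le_refl 2) (by norm_num : 1 ≤ 8)]
  norm_num [logb_two_eight]

/-- The first right rung: `R̃(⟨2,2,4⟩) ≤ 8 ↔ ω(1,1,2) = 3`.
[cite: ChristandlLeGallLysikovZuiddam2020, §1] -/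
theorem asymptoticRank_224_le_iff : asymptoticRank (matMulTensor K 2 2 4) ≤ 8 ↔ omegaRect K 1 1 2 = 3 := by
  rw [asymptoticRank_224_eq_rpow, show (8 : ℝ) = (2 : ℝ) ^ (3 : ℝ) by norm_num,
    Real.rpow_le_rpow_left_iff one_lt_two]
  have hlow : (3 : ℝ) ≤ omegaRect K 1 1 2 := by
    have := max_two_add_one_le_omegaRect K 2
    norm_num at this
    exact this
  exact ⟨fun h => le_antisymm h hlow, fun h => h.le⟩

/-- The second right rung: `R̃(⟨2,2,8⟩) ≤ 16 ↔ ω(1,1,3) = 4`.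
[cite: ChristandlLeGallLysikovZuiddam2020, §1] -/
theorem asymptoticRank_228_le_iff :
    asymptoticRank (matMulTensor K 2 2 8) ≤ 16 ↔ omegaRect K 1 1 3 = 4 := by
  rw [asymptoticRank_228_eq_rpow, show (16 : ℝ) = (2 : ℝ) ^ (4 : ℝ) by norm_num,
    Real.rpow_le_rpow_left_iff one_lt_two]
  have hlow : (4 : ℝ) ≤ omegaRect K 1 1 3 := by
    have := max_two_add_one_le_omegaRect K 3
    norm_num at this
    exact this
  exact ⟨fun h => le_antisymm h hlow, fun h => h.le⟩

/-- Over `ℂ`: **`MatrixMultiplication → R̃(⟨2,2,4⟩) ≤ 8`** (the first right rung; its CW_q-barrier is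
`ω(2) ≥ 3.0551 > 3` for every `q ≥ 1`, CLLZ 2020 §4.4). [cite: ChristandlLeGallLysikovZuiddam2020, §1 and §4.4] -/
theorem asymptoticRank_224_le_of_matrixMultiplication (h : _root_.MatrixMultiplication) :
    asymptoticRank (matMulTensor ℂ 2 2 4) ≤ 8 := by
  rw [asymptoticRank_224_le_iff,
    (omega_eq_two_iff_forall_omegaRect_eq_max ℂ).1 (MatrixMultiplication_iff.1 h) 2]
  norm_num

/-- **`R̃(⟨2,2,4⟩) ≤ 8 → R̃(⟨2,2,8⟩) ≤ 16`** (every field): the second right rung follows from the first.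
[cite: LottiRomani1983, §2 (p. 174)] -/
theorem asymptoticRank_228_le_of_224_le (h : asymptoticRank (matMulTensor K 2 2 4) ≤ 8) :
    asymptoticRank (matMulTensor K 2 2 8) ≤ 16 := by
  rw [asymptoticRank_224_le_iff] at h
  rw [asymptoticRank_228_le_iff]
  have h3 := omegaRect_eq_add_one_mono K (by norm_num : (2 : ℝ) ≤ 3) (by rw [h]; norm_num)
  rw [h3]
  norm_num

/-! ## Never attained on the right, and the numerics of the first two right rungs -/

/-- **`(n^{k+1})^N < R̲(⟨n,n,n^k⟩^{⊠N})`** for all `n ≥ 2`, `N ≥ 1`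
(`R̲(⟨n^N, n^N, n^{kN}⟩) ≥ n^{(k+1)N} + n^N − 1`, Lickteig). [cite: Lickteig1984, main result] -/
theorem pow_lt_algBorderRank_kroneckerPow_right {n : ℕ} (hn : 2 ≤ n) (k : ℕ) {N : ℕ} (hN : 1 ≤ N) :
    (n ^ (k + 1)) ^ N < algBorderRank (kroneckerPow (matMulTensor K n n (n ^ k)) N) := by
  rw [algBorderRank_kroneckerPow_matMulTensor]
  have e : (n ^ (k + 1)) ^ N = n ^ N * (n ^ k) ^ N := by rw [pow_succ, mul_pow, mul_comm]
  rw [e]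
  have h2N : 2 ≤ n ^ N := le_trans hn (Nat.le_self_pow (by omega) n)
  have hkN : 1 ≤ (n ^ k) ^ N := Nat.one_le_pow _ _ (Nat.pow_pos (by omega))
  obtain ⟨l, hl⟩ : ∃ l, n ^ N = l + 1 := ⟨n ^ N - 1, by omega⟩
  rw [hl]
  have h := mul_add_le_algBorderRank_matMulTensor K l (l + 1) ((n ^ k) ^ N) (by omega) hkN
  omega

/-- `2^{7/2} < 12` (`128 < 144`). [folklore] -/
theorem two_rpow_seven_halves_lt_twelve : (2 : ℝ) ^ (3.5 : ℝ) < 12 := by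
  by_contra hc
  push Not at hc
  have h := pow_le_pow_left₀ (by norm_num) hc 2
  have e : ((2 : ℝ) ^ (3.5 : ℝ)) ^ 2 = 128 := by
    rw [← Real.rpow_natCast, ← Real.rpow_mul (by norm_num : (0 : ℝ) ≤ 2),
      show (3.5 : ℝ) * ((2 : ℕ) : ℝ) = ((7 : ℕ) : ℝ) by norm_num, Real.rpow_natCast]
    norm_num
  rw [e] at h
  norm_num at h

/-- `2^{9/2} < 24` (`512 < 576`). [folklore] -/
theorem two_rpow_nine_halves_lt_twentyfour : (2 : ℝ) ^ (4.5 : ℝ) < 24 := by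
  by_contra hc
  push Not at hc
  have h := pow_le_pow_left₀ (by norm_num) hc 2
  have e : ((2 : ℝ) ^ (4.5 : ℝ)) ^ 2 = 512 := by
    rw [← Real.rpow_natCast, ← Real.rpow_mul (by norm_num : (0 : ℝ) ≤ 2),
      show (4.5 : ℝ) * ((2 : ℕ) : ℝ) = ((9 : ℕ) : ℝ) by norm_num, Real.rpow_natCast]
    norm_num
  rw [e] at h
  norm_num at h

/-- **First right rung, numerics** (ℂ, given VWXXZ 2024 Table 1, row `κ = 2`): `R̃(⟨2,2,4⟩) ≤
2^{3.250385} < 12 ≤ R̲(⟨2,2,4⟩)` (Landsberg–Ryder: `3n ≤ R̲(⟨n,2,2⟩)`), so `R̃ < R̲` at level one.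
[cite: VassilevskaWilliamsXuXuZhou2024, §1.1 Table 1] [cite: LandsbergRyder2015, §3] -/
theorem asymptoticRank_224_lt_algBorderRank (h : vxxz2024_omegaRect_table) :
    asymptoticRank (matMulTensor ℂ 2 2 4) < (algBorderRank (matMulTensor ℂ 2 2 4) : ℝ) := by
  have h2 : omegaRect ℂ 1 1 2 ≤ 3.250385 := by
    have := h 2 3.250385 (by norm_num [vxxz2024Table])
    rwa [omegaRect_one_mid_one] at this
  have h3 : (12 : ℝ) ≤ algBorderRank (matMulTensor ℂ 2 2 4) := by
    have := three_mul_le_algBorderRank_matMulTensor_n22 ℂ 4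
    rw [algBorderRank_matMulTensor_rotate ℂ 4 2 2] at this
    exact_mod_cast this
  rw [asymptoticRank_224_eq_rpow]
  calc (2 : ℝ) ^ omegaRect ℂ 1 1 2 ≤ (2 : ℝ) ^ (3.5 : ℝ) :=
        Real.rpow_le_rpow_of_exponent_le one_le_two (by linarith)
    _ < 12 := two_rpow_seven_halves_lt_twelve
    _ ≤ _ := h3

/-- **Second right rung, numerics** (ℂ, row `κ = 3`): `R̃(⟨2,2,8⟩) ≤ 2^{4.198809} < 24 ≤ R̲(⟨2,2,8⟩)`.
[cite: VassilevskaWilliamsXuXuZhou2024, §1.1 Table 1] [cite: LandsbergRyder2015, §3] -/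
theorem asymptoticRank_228_lt_algBorderRank (h : vxxz2024_omegaRect_table) :
    asymptoticRank (matMulTensor ℂ 2 2 8) < (algBorderRank (matMulTensor ℂ 2 2 8) : ℝ) := by
  have h2 : omegaRect ℂ 1 1 3 ≤ 4.198809 := by
    have := h 3 4.198809 (by norm_num [vxxz2024Table])
    rwa [omegaRect_one_mid_one] at this
  have h3 : (24 : ℝ) ≤ algBorderRank (matMulTensor ℂ 2 2 8) := by
    have := three_mul_le_algBorderRank_matMulTensor_n22 ℂ 8
    rw [algBorderRank_matMulTensor_rotate ℂ 8 2 2] at this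
    exact_mod_cast this
  rw [asymptoticRank_228_eq_rpow]
  calc (2 : ℝ) ^ omegaRect ℂ 1 1 3 ≤ (2 : ℝ) ^ (4.5 : ℝ) :=
        Real.rpow_le_rpow_of_exponent_le one_le_two (by linarith)
    _ < 24 := two_rpow_nine_halves_lt_twentyfour
    _ ≤ _ := h3

end Summit.MatrixMultiplication.MatrixMultiplication.Theorems
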